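import Summits.CriticalPhenomena.PercolationContinuityZ3.Theorems.Transplant.FKConnectivityAllQPat3ThetaJoin
import HarnessLib

/-!
# Connectivity correlation inequalities for `φ_{w,q}`, every `q > 0` — the CORNER (type-II two-sum) gluing: patterns, antipodal
# exponent and the bilinear decomposition (Stage S3, part 1)

Definitions + theorems file (`--supports stmt-CriticalPhenomena-4575`), census lane `prim-bschramm-census` (gen 36) of the post-continuity programme (LANE 2 bschramm, FK sub-lane);
builds on p205010 (kernel theorem, internal audit signed; external expert review pending).
No named facts, no sorries; standard axioms.  Census g32 §4.1's TYPE-II configuration — two pieces `Q₁ ∋ s`, `Q₂ ∋ t` glued in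
parallel between `u, v`, the composite read on the marks `(u, s, t)` (one mark AT the corner `u`): `FK.joinC` / `FK.corrC`,
`FK.pat3_union2_corner`, `FK.apExp_union2_corner` (= fk-2's `FK.apExp_parallel`), **`FK.tval_union2_corner`** (the bilinear
decomposition).  With the product-cone machinery of `…Pat3SymCone` / `…Pat3FastCheck` (embedded as a three-piece gluing with an
empty third piece, file `…Pat3CornerCone.lean`) this yields `T_sym`/`STAR ≥ 0` for the placement {corner, inner, inner}.
[cite: AyyerLinussonRavichandran2025, §7 eq. (13)–(15) (p. 22)] [cite: Grimmett2006, §3.8 (pp. 61–62)]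
-/

noncomputable section

namespace Summit.CriticalPhenomena.PercolationContinuityZ3.Theorems

namespace FK

open SimpleGraph Literature.Probability.LatticeModels Literature.Probability.Percolation

/-! ### The CORNER (type-II two-sum) configuration: two pieces in parallel between `u, v`, marks `(u, s, t)` (census g32 §4.1) -/

/-- **CORNER join**: the pattern of `γ₁ ∪ γ₂` on the marks `(u, s, t)` — the corner `u`, the mark `s` of the first piece, the
mark `t` of the second piece — from the pieces' patterns on `(u, v, s)` and `(u, v, t)` (`toU`/`toV` = "the mark reaches
`u`/`v`" given whether the corners are joined). [folklore] -/
def joinC (P1 P2 : Pat3) : Pat3 :=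
  Pat3.ofBits (P1.toU (P1.xy || P2.xy)) (P2.toU (P1.xy || P2.xy))
    ((P1.toU (P1.xy || P2.xy) && P2.toU (P1.xy || P2.xy)) || (P1.toV (P1.xy || P2.xy) && P2.toV (P1.xy || P2.xy)))

/-- **CORNER level correction**: one extra cycle when both pieces join the corners. [folklore] -/
def corrC (P1 P2 : Pat3) : ℕ := if P1.xy && P2.xy then 1 else 0

/-- The CORNER correction is at most `1`. [folklore] -/
theorem corrC_le_one : ∀ P1 P2 : Pat3, corrC P1 P2 ≤ 1 := by decide

section Corner

open scoped Classical

variable {V : Type*} {E₁ E₂ : Finset (Sym2 V)} {V₁ V₂ : Set V} {u v : V}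

/-- **PATTERN GLUING FOR THE CORNER CONFIGURATION**: for two pieces `Q₁ ∋ s`, `Q₂ ∋ t` (marks off the other piece and off
the corners) glued in parallel between `u, v`, the pattern of `γ₁ ∪ γ₂` on `(u, s, t)` is `joinC` of the pieces' patterns on
`(u, v, s)`, `(u, v, t)`. [folklore] -/
theorem pat3_union2_corner (h₁ : ∀ e ∈ (↑E₁ : Set (Sym2 V)), ∀ z ∈ e, z ∈ V₁)
    (h₂ : ∀ e ∈ (↑E₂ : Set (Sym2 V)), ∀ z ∈ e, z ∈ V₂) (h12 : V₁ ∩ V₂ ⊆ ({u, v} : Set V)) {s t : V}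
    (hs2 : s ∉ V₂) (ht1 : t ∉ V₁) (hsu : s ≠ u) (hsv : s ≠ v) (htu : t ≠ u) (htv : t ≠ v) (hst : s ≠ t)
    {γ₁ γ₂ : Finset (Sym2 V)} (g₁ : γ₁ ⊆ E₁) (g₂ : γ₂ ⊆ E₂) :
    pat3 (γ₁ ∪ γ₂) u s t = joinC (pat3 γ₁ u v s) (pat3 γ₂ u v t) := by
  have h21 : V₂ ∩ V₁ ⊆ ({u, v} : Set V) := fun z hz => h12 ⟨hz.2, hz.1⟩
  have pc : ({v, u} : Set V) = {u, v} := Set.pair_comm _ _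
  -- `u ~ v`
  have euv := reachable_union_parallel h₁ h₂ h12 g₁ g₂
  -- mark/corner relations
  have e_ut := reachable_union_par_third h₁ h₂ h12 ht1 htu htv g₁ g₂
  have e_vt := reachable_union_par_third (x := v) (y := u) h₁ h₂ (by rwa [pc]) ht1 htv htu g₁ g₂
  have e_us := reachable_union_par_third h₂ h₁ h21 hs2 hsu hsv g₂ g₁
  rw [Finset.union_comm γ₂] at e_us
  have e_vs := reachable_union_par_third (x := v) (y := u) h₂ h₁ (by rwa [pc]) hs2 hsv hsu g₂ g₁
  rw [Finset.union_comm γ₂] at e_vs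
  have e_st := reachable_union_marks h₁ h₂ h12 (m := s) (m' := t) hs2 ht1 hsu hsv hst g₁ g₂
  have b11 := pat3_xy_iff γ₁ u v s
  have b12 := pat3_xs_iff γ₁ u v s
  have b13 := pat3_ys_iff γ₁ u v s
  have b21 := pat3_xy_iff γ₂ u v t
  have b22 := pat3_xs_iff γ₂ u v t
  have b23 := pat3_ys_iff γ₂ u v t
  have buv : ((pat3 γ₁ u v s).xy || (pat3 γ₂ u v t).xy) = true ↔
      (openGraph (↑γ₁ : BondConfig V)).Reachable u v ∨ (openGraph (↑γ₂ : BondConfig V)).Reachable u v := by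
    rw [Bool.or_eq_true, b11, b21]
  have p1 : ((openGraph (↑γ₂ : BondConfig V)).Reachable u v ∨ (openGraph (↑γ₁ : BondConfig V)).Reachable u v) ↔
      ((openGraph (↑γ₁ : BondConfig V)).Reachable u v ∨ (openGraph (↑γ₂ : BondConfig V)).Reachable u v) := Or.comm
  have s1 : (openGraph (↑γ₁ : BondConfig V)).Reachable v u ↔ (openGraph (↑γ₁ : BondConfig V)).Reachable u v :=
    ⟨Reachable.symm, Reachable.symm⟩
  have s2 : (openGraph (↑γ₂ : BondConfig V)).Reachable v u ↔ (openGraph (↑γ₂ : BondConfig V)).Reachable u v :=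
    ⟨Reachable.symm, Reachable.symm⟩
  have q0 : ((openGraph (↑γ₁ : BondConfig V)).Reachable v u ∨ (openGraph (↑γ₂ : BondConfig V)).Reachable v u) ↔
      ((openGraph (↑γ₁ : BondConfig V)).Reachable u v ∨ (openGraph (↑γ₂ : BondConfig V)).Reachable u v) := by rw [s1, s2]
  have q1 : ((openGraph (↑γ₂ : BondConfig V)).Reachable v u ∨ (openGraph (↑γ₁ : BondConfig V)).Reachable v u) ↔
      ((openGraph (↑γ₁ : BondConfig V)).Reachable u v ∨ (openGraph (↑γ₂ : BondConfig V)).Reachable u v) := by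
    rw [s1, s2]; exact Or.comm
  have Xt := Pat3.toU_iff b22 b23 buv e_ut
  have Yt := Pat3.toV_iff b22 b23 (buv.trans q0.symm) e_vt
  have Xs := Pat3.toU_iff b12 b13 (buv.trans p1.symm) e_us
  have Ys := Pat3.toV_iff b12 b13 (buv.trans q1.symm) e_vs
  have E3 : (openGraph (↑(γ₁ ∪ γ₂) : BondConfig V)).Reachable s t ↔
      ((openGraph (↑(γ₁ ∪ γ₂) : BondConfig V)).Reachable u s ∧ (openGraph (↑(γ₁ ∪ γ₂) : BondConfig V)).Reachable u t) ∨
        ((openGraph (↑(γ₁ ∪ γ₂) : BondConfig V)).Reachable v s ∧ (openGraph (↑(γ₁ ∪ γ₂) : BondConfig V)).Reachable v t) := by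
    rw [e_st]
    constructor
    · rintro (⟨h1, h2⟩ | ⟨h1, h2⟩)
      · exact Or.inl ⟨h1.symm, h2⟩
      · exact Or.inr ⟨h1.symm, h2⟩
    · rintro (⟨h1, h2⟩ | ⟨h1, h2⟩)
      · exact Or.inl ⟨h1.symm, h2⟩
      · exact Or.inr ⟨h1.symm, h2⟩
  rw [pat3_eq_ofBits]
  unfold joinC
  have c1 := conn_iff (γ₁ ∪ γ₂) u s
  have c2 := conn_iff (γ₁ ∪ γ₂) u t
  have c3 := conn_iff (γ₁ ∪ γ₂) s t
  congr 1
  · exact Bool.eq_iff_iff.2 (c1.trans Xs.symm)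
  · exact Bool.eq_iff_iff.2 (c2.trans Xt.symm)
  · exact Bool.eq_iff_iff.2 (c3.trans (E3.trans (bool_or_and_iff Xs Xt Ys Yt).symm))

end Corner

/-! ### CORNER gluing: the antipodal exponent and the bilinear decomposition -/

section CornerExp

open scoped Classical

variable {V : Type*} [Fintype V] {E₁ E₂ : Finset (Sym2 V)} {V₁ V₂ : Set V} {u v : V}

/-- **ANTIPODAL EXPONENT ACROSS A CORNER GLUING** (fk-2's `FK.apExp_parallel`): `k(γ)+k(γᶜ)+2|V| = Σ_p (k(γ_p)+k(γ_pᶜ))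
+ corrC(patterns) + corrC(complement patterns)`. [folklore] -/
theorem apExp_union2_corner (hd : Disjoint E₁ E₂) (h₁ : ∀ e ∈ (↑E₁ : Set (Sym2 V)), ∀ z ∈ e, z ∈ V₁)
    (h₂ : ∀ e ∈ (↑E₂ : Set (Sym2 V)), ∀ z ∈ e, z ∈ V₂) (h12 : V₁ ∩ V₂ ⊆ ({u, v} : Set V)) (huv : u ≠ v) (s t : V)
    {γ₁ γ₂ : Finset (Sym2 V)} (g₁ : γ₁ ⊆ E₁) (g₂ : γ₂ ⊆ E₂) :
    apExp (E₁ ∪ E₂) (γ₁ ∪ γ₂) + 2 * Fintype.card V =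
      apExp E₁ γ₁ + apExp E₂ γ₂ + corrC (pat3 γ₁ u v s) (pat3 γ₂ u v t) +
        corrC (pat3 (E₁ \ γ₁) u v s) (pat3 (E₂ \ γ₂) u v t) := by
  have e1 := apExp_parallel hd h₁ h₂ h12 huv le_rfl le_rfl g₁ g₂
  rw [ite_prop_eq_ite_bool (p := (openGraph (↑γ₁ : BondConfig V)).Reachable u v ∧ (openGraph (↑γ₂ : BondConfig V)).Reachable u v)
      (bb := (pat3 γ₁ u v s).xy && (pat3 γ₂ u v t).xy) (by rw [Bool.and_eq_true, pat3_xy_iff, pat3_xy_iff]),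
    ite_prop_eq_ite_bool
      (p := (openGraph (↑(E₁ \ γ₁) : BondConfig V)).Reachable u v ∧ (openGraph (↑(E₂ \ γ₂) : BondConfig V)).Reachable u v)
      (bb := (pat3 (E₁ \ γ₁) u v s).xy && (pat3 (E₂ \ γ₂) u v t).xy) (by rw [Bool.and_eq_true, pat3_xy_iff, pat3_xy_iff])] at e1
  unfold corrC
  omega

/-- **BILINEAR DECOMPOSITION OF `tval` OVER A CORNER GLUING** (census g32 §2.1, "the r-linear form" for `r = 2` at a
2-separation through a marked terminal). [folklore] -/
theorem tval_union2_corner (hd : Disjoint E₁ E₂) (h₁ : ∀ e ∈ (↑E₁ : Set (Sym2 V)), ∀ z ∈ e, z ∈ V₁)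
    (h₂ : ∀ e ∈ (↑E₂ : Set (Sym2 V)), ∀ z ∈ e, z ∈ V₂) (h12 : V₁ ∩ V₂ ⊆ ({u, v} : Set V)) (huv : u ≠ v)
    {s t : V} (hs2 : s ∉ V₂) (ht1 : t ∉ V₁) (hsu : s ≠ u) (hsv : s ≠ v) (htu : t ≠ u) (htv : t ≠ v) (hst : s ≠ t)
    (w : ℕ → ℝ) (tab : Pat3 → Pat3 → ℤ) :
    tval (fun n => w (n + 2 * Fintype.card V)) (E₁ ∪ E₂) u s t tab =
      ∑ γ₁ ∈ E₁.powerset, ∑ γ₂ ∈ E₂.powerset,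
        w (apExp E₁ γ₁ + apExp E₂ γ₂ + corrC (pat3 γ₁ u v s) (pat3 γ₂ u v t) +
            corrC (pat3 (E₁ \ γ₁) u v s) (pat3 (E₂ \ γ₂) u v t)) *
          (tab (joinC (pat3 γ₁ u v s) (pat3 γ₂ u v t)) (joinC (pat3 (E₁ \ γ₁) u v s) (pat3 (E₂ \ γ₂) u v t)) : ℝ) := by
  unfold tval
  beta_reduce
  rw [sum_powerset_union_disj hd]
  refine Finset.sum_congr rfl fun γ₁ hγ₁ => Finset.sum_congr rfl fun γ₂ hγ₂ => ?_
  have g₁ := Finset.mem_powerset.1 hγ₁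
  have g₂ := Finset.mem_powerset.1 hγ₂
  rw [union_sdiff_union hd g₁ g₂, apExp_union2_corner hd h₁ h₂ h12 huv s t g₁ g₂,
    pat3_union2_corner h₁ h₂ h12 hs2 ht1 hsu hsv htu htv hst g₁ g₂,
    pat3_union2_corner h₁ h₂ h12 hs2 ht1 hsu hsv htu htv hst Finset.sdiff_subset Finset.sdiff_subset]

end CornerExp

end FK

end Summit.CriticalPhenomena.PercolationContinuityZ3.Theorems

end
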